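import Literature.NumberTheory.LFunctions.Zhang2022.RepairIntakeBellMembers
import Literature.NumberTheory.LFunctions.Zhang2022.RepairInPrintLengthsCeiling
import Literature.NumberTheory.LFunctions.Zhang2022.RepairIntakeBfam
import Literature.NumberTheory.LFunctions.Zhang2022.RepairIntakeBdet
import Literature.NumberTheory.LFunctions.Zhang2022.RepairIntakeBlen
import HarnessLib

/-!
# Kernel satisfiability witnesses (W1) for the arithmetic exponent boxes and design classes of the §B intake files

Topic `Literature/NumberTheory/LFunctions/Zhang2022` (Landau–Siegel audit tree; verdict-neutral), cell landau-siegel, D-0124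
rescue — W1 satisfiability-witness rule (21-frontier 2026-08-27 11:02:49Z; director-frontier 11:10:43Z; grammar of record
ls-rescue-lead 11:18:07Z: a certificate `H₁ ∧ … ∧ Hₙ → C` is WITNESSED(a) when a landed object instantiates its side
hypotheses jointly). PROOFS only — no definition, no named fact (D-0026); typer seat ls-rescue-typ-1.

WHY. The kernel census of ls-rescue-ref-1 (SAT-CENSUS v2, 2026-08-27 12:44Z) lists as UNWITNESSED «by head» the
certificates whose hypotheses are the ARITHMETIC exponent boxes / design-class predicates of the intake files
(`Repair.EllAdmissible`, `EllRegime.TExponentConstraints`, `Repair.ALS24Range/CIS19Range/BPRZ11Range/BPRZ12Range/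
PrintedAsymptoticRange`, `Repair.KDiag`, `Repair.KBdet/KBdet2`, `Repair.KBlen3`) and the displayed-hypothesis SHAPES
`Repair.BAH/HExp/HExpII`: no in-tree theorem CONCLUDES these heads, so the closure could not certify that the boxes are
non-empty. This file lands one explicit, named inhabitant per head — the failure mode the W1 rule hunts (a box pinned
empty by two incompatible constraints) is thereby excluded IN THE KERNEL for each of them:

* `ellAdmissible_zero_printed`, `ellAdmissible_one_printed` — ZHANG'S OWN exponents `(e₁,e₂,e₃,cut) = (0.504, 0.5, 0.498, 0.5)`
  (Zhang 2022 (2.21)–(2.26)) on the limit sheet `τ_T = α̃ = 0` satisfy §2 admissibility (a)–(f) of KILL-CERT(B-ell) —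
  (a) and the cap hold AT EQUALITY (`2e₂ = X = 1`): the printed design sits on the boundary of the class it is killed in;
* `tExponentConstraints_theta0_limit` — E-027's `TExponentConstraints θ₀ 0 0 0` (again with the cap at equality);
* `als24Range_half`, `cis19Range_half`, `bprz11Range_half`, `bprz12Range_half`, `printedAsymptoticRange_half` — the
  printed asymptotic ranges all contain the diagonal length `ν = ½`;
* `kDiag_poly_half_X_sq` (KMV's `P = X²`, `Δ = ½`, via `KMV2000.admissible_X_sq`), `kDiag_ac_one_const`;
* `admissibleThetaCalc_theta0`, `kBdet_w1calc_theta0`, `kBdet2_ofV1_w1calc_theta0` (the printed design is a member of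
  the covered DET family, via `Repair.admissible_theta0`);
* `nuLipDesign_inClass_zero`, `kBlen3_nuLip_zero` — the ν-Lipschitz sub-class has the (DEGENERATE, zero-profile) member
  `⟨3/2, 0, 0⟩`; labelled degenerate: it witnesses that the box `1 < θ < 2 ∧ Lipschitz ∧ support` is consistent, no more;
  Rev 2 (append): the NON-DEGENERATE member `⟨3/2, 1, tent⟩`, `tent(z) = max(0, min(z − 1, 3/2 − z))` (a genuine
  1-Lipschitz bump supported on `[1, 3/2]`, `ν ≢ const`): `nuLipDesign_inClass_tent`, `kBlen3_nuLip_tent` (private `tent_lipschitz`);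
* `bah_zero`, `hexp_zero`, `hexpII_zero` — ZERO-MODEL inhabitants of the displayed-hypothesis SHAPES (`Q ≡ 0`, data
  `0`, `K = 0`): SHAPE-CONSISTENCY ONLY. The CONTENT of these slots is E-022 / D-ELL-1c (print §§8–9 asymptotics), which
  no kernel object instantiates; per the W1 grammar such certificates stay «(a)-emulated / W-mod-𝒜» at best — this file
  does not claim otherwise.

Nothing here is a claim about the manuscript, about (A), or about any verdict. «The programme SEARCHES and TYPES; no claim
about Landau–Siegel zeros, Theorems 1–2 of arXiv:2211.02515 or a repaired Margin232 until a kernel theorem says so.»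

## References

* [Zhang2022LandauSiegel] Y. Zhang, arXiv:2211.02515v1, §2 (2.21)–(2.30), §7 (7.2), §14 (14.2), §15 (15.2).
* [KowalskiMichelVanderKam2000] E. Kowalski, P. Michel, J. VanderKam, J. reine angew. Math. 526 (2000), Props. 4.1/5.1,
  §6 (35) (`P₀(x) = x²`).
* [ConreyIwaniecSoundararajan2011ALS] / [ConreyIwaniecSoundararajan2019MeanSquare] / [BuiPrattRoblesZaharescu2020] —
  the printed ranges typed in `RepairInPrintLengthsCeiling`.
* Tree: `RepairIntakeBellMembers` (p480487/p486704), `RepairInPrintLengthsCeiling`, `RepairIntakeBfam`, `RepairIntakeBdet`,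
  `RepairIntakeBlen`, `EllRegimeStatements`, `RepairTheta`/`RepairAdmissible` (`theta0`, `admissible_theta0`).
-/

noncomputable section

open Polynomial

namespace Literature.NumberTheory.LFunctions.Zhang2022.Repair.SatWitness

open Literature.NumberTheory.LFunctions.Zhang2022.Repair
open Literature.NumberTheory.LFunctions

/-! ### The ℓ-intake admissibility box (KILL-CERT(B-ell) §2 (a)–(f)) contains Zhang's printed exponents -/

/-- **Zhang's printed exponents are §2-admissible on the limit sheet, P-sharp caps (`x = 0`)**:
`(e₁,e₂,e₃,cut) = (0.504, 0.5, 0.498, 0.5)`, `τ_T = α̃ = 0` (`X = 1`; (a) `2e₂ = 1 ≤ 1` at equality, (e) `1.004 > 1`,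
(f) `1.002 > 1`). [cite: Zhang2022LandauSiegel, §2 (2.21)–(2.26); §14 (14.2)] -/
theorem ellAdmissible_zero_printed : EllAdmissible 0 ⟨0.504, 0.5, 0.498, 0.5⟩ ⟨0, 0⟩ := by
  unfold EllAdmissible capX
  norm_num

/-- … and with conductor-natural caps (`x = 1`). [cite: Zhang2022LandauSiegel, §2 (2.21)–(2.26); §15 (15.2)] -/
theorem ellAdmissible_one_printed : EllAdmissible 1 ⟨0.504, 0.5, 0.498, 0.5⟩ ⟨0, 0⟩ := by
  unfold EllAdmissible capX
  norm_num

/-- **E-027's `T`-exponent constraints hold for the printed design `θ₀` on the limit sheet** `τ_T = τ_{t₀} = α̃ = 0`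
(the cap `max(cut₁, ν₂) + max(ν₃, ν₂) = 1 ≤ 1` at equality; `1 < ν₁ + ν₂ = 1.004`).
[cite: Zhang2022LandauSiegel, §2 (2.21), (2.30); §7 (7.2)] -/
theorem tExponentConstraints_theta0_limit : EllRegime.TExponentConstraints theta0 0 0 0 := by
  unfold EllRegime.TExponentConstraints theta0
  norm_num

/-! ### The printed asymptotic ranges contain the diagonal length `ν = ½` -/

/-- `ν = ½` is in the range of the asymptotic large sieve Thm 2.4 reading (`ε = δ = ¼`).
[cite: ConreyIwaniecSoundararajan2011ALS, Theorem 2.4] -/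
theorem als24Range_half : ALS24Range (1 / 2) :=
  ⟨1 / 4, 1 / 4, by norm_num, by norm_num, by norm_num, by norm_num, by norm_num⟩

/-- `ν = ½` is in the CIS 2019 range (`ϑ = ½`, saving exponent `2 − ¼ < 2`).
[cite: ConreyIwaniecSoundararajan2019MeanSquare, Theorem 1] -/
theorem cis19Range_half : CIS19Range (1 / 2) :=
  ⟨1 / 2, by norm_num, by unfold CIS2019.savingExponent; norm_num, le_rfl⟩

/-- `ν = ½` is in the BPRZ 2020 Thm 1.1 range (`κ = ½ < ½ + 1/202`). [cite: BuiPrattRoblesZaharescu2020, Theorem 1.1] -/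
theorem bprz11Range_half : BPRZ11Range (1 / 2) :=
  ⟨1 / 2, by norm_num, by norm_num, le_rfl⟩

/-- `ν = ½` is in the BPRZ 2020 Thm 1.2 range (`κ₁ = κ₂ = ¼`: `9·½ + ¼ = 4.75 < 5`).
[cite: BuiPrattRoblesZaharescu2020, Theorem 1.2] -/
theorem bprz12Range_half : BPRZ12Range (1 / 2) :=
  ⟨1 / 4, 1 / 4, by norm_num, by norm_num, by rw [max_self]; norm_num, by norm_num⟩

/-- Hence `ν = ½` lies in the PRINTED asymptotic range (any disjunct). [cite: ConreyIwaniecSoundararajan2011ALS, Theorem 2.4] -/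
theorem printedAsymptoticRange_half : PrintedAsymptoticRange (1 / 2) :=
  Or.inl als24Range_half

/-! ### The diagonal family `K_fam^diag` and the covered DET family have named members -/

/-- KMV's profile `P₀ = X²` at `Δ = ½` is a member of `K_fam^diag` (polynomial sub-class; `KMV2000.admissible_X_sq`).
[cite: KowalskiMichelVanderKam2000, Props 4.1/5.1, §6 (35)] -/
theorem kDiag_poly_half_X_sq : KDiag (.poly .levelIndividual (1 / 2) (X ^ 2)) :=
  ⟨by norm_num, by norm_num, KMV2000.admissible_X_sq⟩

/-- The constant profile `q ≡ 1` at `Δ = 1` is a member of `K_fam^diag` (a.c. sub-class).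
[cite: KowalskiMichelVanderKam2000, Thm 6.1] -/
theorem kDiag_ac_one_const : KDiag (.ac .levelIndividual 1 fun _ => 1) := by
  refine ⟨by norm_num, le_rfl, ?_, ?_⟩
  · exact intervalIntegrable_const
  · simp only [one_pow]; exact intervalIntegrable_const

/-- The printed design `θ₀` is in the calculus class `R_calc` (`admissible_theta0.toCalc`).
[cite: Zhang2022LandauSiegel, §2 (2.21)–(2.26)] -/
theorem admissibleThetaCalc_theta0 : AdmissibleThetaCalc theta0 := admissible_theta0.toCalc

/-- … hence a member of the covered DET family (`w1calc` sub-class). [cite: Zhang2022LandauSiegel, §2 (2.32)–(2.33)] -/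
theorem kBdet_w1calc_theta0 : KBdet (.w1calc theta0) := admissibleThetaCalc_theta0

/-- … and of its v2 extension. [cite: Zhang2022LandauSiegel, §2 (2.32)–(2.33)] -/
theorem kBdet2_ofV1_w1calc_theta0 : KBdet2 (.ofV1 (.w1calc theta0)) := admissibleThetaCalc_theta0

/-! ### The ν-Lipschitz overhang sub-class is non-empty (degenerate member) -/

/-- The zero profile with `θ = 3/2`, `K = 0` is a (DEGENERATE) member of the ν-Lipschitz overhang class: the box
`1 < θ < 2 ∧ LipschitzWith K v ∧ v = 0 off [1,θ]` is consistent. Degenerate by design (zero overhang); it witnesses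
joint satisfiability of the membership binders, not a non-trivial design. [cite: Zhang2022LandauSiegel, §7 (7.2) p.44] -/
theorem nuLipDesign_inClass_zero : NuLipDesign.InClass ⟨3 / 2, 0, fun _ => 0⟩ := by
  refine ⟨by norm_num, by norm_num, ?_, fun _ _ => rfl⟩
  exact (LipschitzWith.const (0 : ℂ)).weaken (le_refl _)

/-- … hence `K_len` v3 (`nuLip` sub-class) has a named member. [cite: Zhang2022LandauSiegel, §2 (2.32)–(2.33); §7 (7.2)] -/
theorem kBlen3_nuLip_zero : KBlen3 (.nuLip ⟨3 / 2, 0, fun _ => 0⟩) := nuLipDesign_inClass_zero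

/-! ### Zero-model inhabitants of the displayed-hypothesis SHAPES `BAH` / `HExp` / `HExpII` (shape-consistency only) -/

/-- The identically-zero form satisfies the non-negativity shape `BAH` on any datum set. SHAPE-CONSISTENCY ONLY — the
content of this slot (Lemma 2.3 / B-AH, registry E-014) is not instantiated by any kernel object.
[cite: Zhang2022LandauSiegel, §2 Lemma 2.3] -/
theorem bah_zero (𝓜 : Set (ℝ × ℝ)) (A₀ : ℝ) : BAH 𝓜 (fun _ _ => 0) A₀ :=
  fun _ _ _ _ => le_rfl

/-- The identically-zero form with zero first-order data and `K = 0` satisfies the expansion shape `HExp` on any datum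
set (`|0 − 0/A| = 0 ≤ 0/A²`). SHAPE-CONSISTENCY ONLY — the content (E-022, formula I) is not instantiated.
[cite: Zhang2022LandauSiegel, §2 (2.32); §8 (8.23)] -/
theorem hexp_zero (𝓜 : Set (ℝ × ℝ)) (A₀ : ℝ) : HExp 𝓜 (fun _ _ => 0) (0, 0, 0, 0) A₀ 0 := by
  intro p _ A _
  simp [EllRegime.firstOrderValue]

/-- The same zero model inhabits the reflected-piece shape `HExpII` (definitionally `HExp`). SHAPE-CONSISTENCY ONLY
(content = D-ELL-1c-II, OWED). [cite: Zhang2022LandauSiegel, §9 (9.1); §12 (12.8)] -/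
theorem hexpII_zero (𝓜 : Set (ℝ × ℝ)) (A₀ : ℝ) : HExpII 𝓜 (fun _ _ => 0) (0, 0, 0, 0) A₀ 0 :=
  hexp_zero 𝓜 A₀

/-- Joint inhabitant of the three slots at once on a NON-EMPTY datum set (`𝓜 = univ`), as consumed together by
`Repair.firstOrderExpansion_of_twoSided` / `vbell_firstOrder_of_twoSided`: the binders `BAH ∧ HExp ∧ HExpII` are jointly
satisfiable (zero model). [cite: Zhang2022LandauSiegel, §2 Lemma 2.3, (2.32)] -/
theorem bah_hexp_hexpII_joint :
    BAH Set.univ (fun _ _ => (0 : ℝ)) 1 ∧ HExp Set.univ (fun _ _ => 0) (0, 0, 0, 0) 1 0 ∧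
      HExpII Set.univ (fun _ _ => 0) (0, 0, 0, 0) 1 0 :=
  ⟨bah_zero _ _, hexp_zero _ _, hexpII_zero _ _⟩

/-! ### Rev 2 (append): a NON-DEGENERATE member of the ν-Lipschitz overhang class (tent profile) -/

/-- The tent `z ↦ max(0, min(z − 1, 3/2 − z))` (as a complex-valued profile) is `1`-Lipschitz on `ℝ`
(min/max of `1`-Lipschitz maps, composed with the isometry `ℝ → ℂ`). [folklore] -/
private theorem tent_lipschitz :
    LipschitzWith 1 (fun z : ℝ => ((max 0 (min (z - 1) (3 / 2 - z)) : ℝ) : ℂ)) := by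
  have h1 : LipschitzWith 1 (fun z : ℝ => z - 1) :=
    (LipschitzWith.id.sub (LipschitzWith.const (1:ℝ))).weaken (by simp)
  have h2 : LipschitzWith 1 (fun z : ℝ => 3 / 2 - z) :=
    ((LipschitzWith.const (3/2:ℝ)).sub LipschitzWith.id).weaken (by simp)
  have h3 : LipschitzWith 1 (fun z : ℝ => max 0 (min (z - 1) (3 / 2 - z))) :=
    ((LipschitzWith.const (0:ℝ)).max (h1.min h2)).weaken (by simp)
  exact (Complex.isometry_ofReal.lipschitz.comp h3).weaken (by simp)

/-- **A NON-DEGENERATE member of the ν-Lipschitz overhang class**: top `θ = 3/2`, Lipschitz constant `K = 1`, profile the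
tent on `[1, 3/2]` (peak `¼` at `z = 5/4`, vanishing off `[1, 3/2]`, not identically zero) — the box
`1 < θ < 2 ∧ LipschitzWith K v ∧ v = 0 off [1,θ]` has a genuine overhang in it, so the KILL of this sub-class
(`KnifeEdge.abs_discMean_add_nuPoly_sub_le`, p468144) bites a non-trivial design. Membership only; no claim that the design
«works». [cite: Zhang2022LandauSiegel, §7 (7.2) p.44] -/
theorem nuLipDesign_inClass_tent :
    NuLipDesign.InClass ⟨3 / 2, 1, fun z => ((max 0 (min (z - 1) (3 / 2 - z)) : ℝ) : ℂ)⟩ := by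
  refine ⟨by norm_num, by norm_num, tent_lipschitz, fun z hz => ?_⟩
  have hmin : min (z - 1) (3 / 2 - z) ≤ 0 := by
    rcases hz with h | h
    · exact min_le_of_left_le (by linarith)
    · exact min_le_of_right_le (by linarith)
  simp [max_eq_left hmin]

/-- … hence `K_len` v3 (`nuLip` sub-class) has a NON-DEGENERATE named member. [cite: Zhang2022LandauSiegel, §2 (2.32)–(2.33); §7 (7.2)] -/
theorem kBlen3_nuLip_tent :
    KBlen3 (.nuLip ⟨3 / 2, 1, fun z => ((max 0 (min (z - 1) (3 / 2 - z)) : ℝ) : ℂ)⟩) :=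
  nuLipDesign_inClass_tent

end Literature.NumberTheory.LFunctions.Zhang2022.Repair.SatWitness

end
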